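import Summits.AnomalousDissipation.AnomalousDissipation.Theorems.SawtoothPulseCascadeK1LocalisedCascadeChirpCoeff

/-!
# K1loc, line `Spectral` / thin start — helper: THE CHIRP CUT-OFF SUM AS FOUR ABEL SUMS; THE SAMPLED TRAPEZOID (S-D, «Osc» 2/3)

Helper file of the prover lane on the crux `K1LocalisedCascade` (stmt-AnomalousDissipation-19491), route
`SawtoothPulseCascade` (S-D fibre ledger; constants of the twist cut-off half-step, memo v14 §3(c)).  Second of three files:
* §3 **`norm_sum_symbol_mul_chirpCoeff_le`**: for `μ > Q`, an EVEN non-negative symbol `t` on `[−Q, Q]` whose ratio `t(q)/(μ+q)` is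
  non-increasing, and the closed form `C_μ(q)` of `…ChirpCoeff.fourierCoeff_exactChirp_eq`:
  `‖Σ_{|q|≤Q} t(q)·C_μ(q)·e^{2πiqx}‖ ≤ (t(−Q)/(μ−Q))/π · (1/|sin π(x+¼)| + 1/|sin π(x−¼)|)` — writing `sin θ = (e^{iθ}−e^{−iθ})/(2i)`
  the sum is `(1/2i)[e^{iπμ/2}F₊(x+¼) − e^{−iπμ/2}F₊(x−¼) + e^{iπμ/2}F₋(x−¾) − e^{−iπμ/2}F₋(x−¼)]`, `F_±(y) = Σ_q (t(q)/(π(μ±q)))e^{2πiqy}`,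
  four Abel sums (`…ChirpCoeff.norm_sum_Icc_antitone_mul_exp_le`);
* §4 `trapezoid_ratio_of_nonpos`, **`trapezoid_sample_facts`**: the maximal-ramp trapezoid `(L₁, L₂)` sampled at the multiples of `N`
  (`μ = L₂/N`, `Q = ⌊(L₂−1)/N⌋`, `D = L₂ − L₁`) is such a symbol, with `t(−Q)/(μ−Q) ≤ N/D`.
No definitions; nothing about the crux. [cite: Grafakos2014, Prop. 3.1.2 (5), §3.1.3] [problem: turb]
-/

-- `Summit.<Summit>.<Problem>`: single-conjunct summit, the duplicate namespace segment is deliberate.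
set_option linter.dupNamespace false

noncomputable section

namespace Summit.AnomalousDissipation.AnomalousDissipation.Theorems.SawtoothPulseCascade.K1Window

open MeasureTheory Set Filter Topology Function Complex AddCircle intervalIntegral
open scoped Real
open Literature.Analysis Literature.Analysis.FunctionSpaces Literature.Analysis.FunctionSpaces.Torus Literature.Analysis.FluidPDE
open Literature.Analysis.FluidPDE.SawtoothCascade
open Summit.AnomalousDissipation.AnomalousDissipation.Theorems.SawtoothPulseCascade.K1Start

/-! ## §3 The cut-off sum against an even symbol with non-increasing ratio: four Abel sums -/

/-- `sin θ = (exp(θi) − exp(−θi))/(2i)` for real `θ`, as a complex identity. [folklore] -/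
theorem ofReal_sin_eq_exp_sub (θ : ℝ) :
    ((Real.sin θ : ℝ) : ℂ) = (Complex.exp ((θ : ℂ) * I) - Complex.exp (-((θ : ℂ) * I))) / (2 * I) := by
  have h := exp_neg_mul_I_sub_exp_mul_I (θ : ℂ)
  rw [Complex.ofReal_sin, eq_div_iff (by simp [Complex.I_ne_zero] : (2 * I : ℂ) ≠ 0)]
  linear_combination h

/-- `|sin π(x − ¾)| = |sin π(x + ¼)|`. [folklore] -/
theorem abs_sin_pi_mul_sub_three_quarters (x : ℝ) :
    |Real.sin (π * (x - 3 / 4))| = |Real.sin (π * (x + 1 / 4))| := by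
  rw [show π * (x - 3 / 4) = π * (x + 1 / 4) - π by ring, Real.sin_sub_pi, abs_neg]

/-- **The chirp cut-off sum as four Abel sums.**  Let `μ > Q` (`Q ∈ ℕ`), `t : ℤ → ℝ` an EVEN non-negative symbol whose ratio
`t(q)/(μ+q)` is non-increasing on `[−Q, Q]`, and `C_μ(q) = sin(π(μ+q)/2)/(π(μ+q)) + e^{−iπq}·sin(π(μ−q)/2)/(π(μ−q))` the closed
form of the one-tooth chirp coefficients (`fourierCoeff_exactChirp_eq`).  Then for `sin π(x ± ¼) ≠ 0`,
`‖Σ_{q∈[−Q,Q]} t(q)·C_μ(q)·e^{2πiqx}‖ ≤ (t(−Q)/(μ−Q))/π · (1/|sin π(x+¼)| + 1/|sin π(x−¼)|)`: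
writing `sin θ = (e^{iθ} − e^{−iθ})/(2i)` the sum is `(1/2i)·[e^{iπμ/2}F₊(x+¼) − e^{−iπμ/2}F₊(x−¼) + e^{iπμ/2}F₋(x−¾) − e^{−iπμ/2}F₋(x−¼)]`
with `F_±(y) = Σ_q (t(q)/(π(μ±q))) e^{2πiqy}`, and each `F` is an Abel sum (`norm_sum_Icc_antitone_mul_exp_le`).
[cite: Grafakos2014, Prop. 3.1.2 (5), §3.1.3] -/
theorem norm_sum_symbol_mul_chirpCoeff_le {μ : ℝ} {Q : ℕ} (hQ : (Q : ℝ) < μ) {t : ℤ → ℝ} (ht0 : ∀ q, 0 ≤ t q)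
    (hte : ∀ q, t (-q) = t q)
    (hanti : ∀ q : ℤ, -(Q : ℤ) ≤ q → q < Q → t (q + 1) / (μ + ((q + 1 : ℤ) : ℝ)) ≤ t q / (μ + q))
    {x : ℝ} (hx₁ : Real.sin (π * (x + 1 / 4)) ≠ 0) (hx₂ : Real.sin (π * (x - 1 / 4)) ≠ 0) :
    ‖∑ q ∈ Finset.Icc (-(Q : ℤ)) Q, (t q : ℂ) *
        (((Real.sin (π * (μ + q) / 2) / (π * (μ + q)) : ℝ) : ℂ) +
          Complex.exp (-(π * I * q)) * ((Real.sin (π * (μ - q) / 2) / (π * (μ - q)) : ℝ) : ℂ)) *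
        Complex.exp (2 * π * I * q * x)‖ ≤
      t (-(Q : ℤ)) / (μ - Q) / π * (1 / |Real.sin (π * (x + 1 / 4))| + 1 / |Real.sin (π * (x - 1 / 4))|) := by
  have hπ : 0 < π := Real.pi_pos
  -- the two coefficient sequences
  set a : ℤ → ℝ := fun q => t q / (π * (μ + q)) with ha
  set a' : ℤ → ℝ := fun q => t q / (π * (μ - q)) with ha'
  have hμq : ∀ q : ℤ, q ∈ Finset.Icc (-(Q : ℤ)) Q → 0 < μ + q ∧ 0 < μ - q := by
    intro q hq
    rw [Finset.mem_Icc] at hq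
    have h1 : (-(Q : ℤ) : ℝ) ≤ q := by exact_mod_cast hq.1
    have h2 : (q : ℝ) ≤ Q := by exact_mod_cast hq.2
    push_cast at h1
    constructor <;> linarith
  -- the unimodular constants and the four shifted characters
  set E₁ : ℂ := Complex.exp (π * I * μ / 2) with hE₁
  set E₂ : ℂ := Complex.exp (-(π * I * μ / 2)) with hE₂
  have hE₁n : ‖E₁‖ = 1 := by
    rw [hE₁, show (π * I * μ / 2 : ℂ) = ((π * μ / 2 : ℝ) : ℂ) * I by push_cast; ring, Complex.norm_exp_ofReal_mul_I]
  have hE₂n : ‖E₂‖ = 1 := by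
    rw [hE₂, show (-(π * I * μ / 2) : ℂ) = ((-(π * μ / 2) : ℝ) : ℂ) * I by push_cast; ring, Complex.norm_exp_ofReal_mul_I]
  -- per-term identity
  have hterm : ∀ q ∈ Finset.Icc (-(Q : ℤ)) Q, (t q : ℂ) *
      (((Real.sin (π * (μ + q) / 2) / (π * (μ + q)) : ℝ) : ℂ) +
        Complex.exp (-(π * I * q)) * ((Real.sin (π * (μ - q) / 2) / (π * (μ - q)) : ℝ) : ℂ)) *
      Complex.exp (2 * π * I * q * x) =
      (1 / (2 * I)) * (E₁ * ((a q : ℂ) * Complex.exp (2 * π * I * q * ((x + 1 / 4 : ℝ) : ℂ))) -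
        E₂ * ((a q : ℂ) * Complex.exp (2 * π * I * q * ((x - 1 / 4 : ℝ) : ℂ))) +
        E₁ * ((a' q : ℂ) * Complex.exp (2 * π * I * q * ((x - 3 / 4 : ℝ) : ℂ))) -
        E₂ * ((a' q : ℂ) * Complex.exp (2 * π * I * q * ((x - 1 / 4 : ℝ) : ℂ)))) := by
    intro q hq
    obtain ⟨hu, hv⟩ := hμq q hq
    have i1 : Complex.exp (((π * (μ + q) / 2 : ℝ) : ℂ) * I) * Complex.exp (2 * π * I * q * x) =
        E₁ * Complex.exp (2 * π * I * q * ((x + 1 / 4 : ℝ) : ℂ)) := by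
      rw [hE₁, ← Complex.exp_add, ← Complex.exp_add]; congr 1; push_cast; ring
    have i2 : Complex.exp (-(((π * (μ + q) / 2 : ℝ) : ℂ) * I)) * Complex.exp (2 * π * I * q * x) =
        E₂ * Complex.exp (2 * π * I * q * ((x - 1 / 4 : ℝ) : ℂ)) := by
      rw [hE₂, ← Complex.exp_add, ← Complex.exp_add]; congr 1; push_cast; ring
    have i3 : Complex.exp (-(π * I * q)) * (Complex.exp (((π * (μ - q) / 2 : ℝ) : ℂ) * I) *
        Complex.exp (2 * π * I * q * x)) = E₁ * Complex.exp (2 * π * I * q * ((x - 3 / 4 : ℝ) : ℂ)) := by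
      rw [hE₁, ← Complex.exp_add, ← Complex.exp_add, ← Complex.exp_add]; congr 1; push_cast; ring
    have i4 : Complex.exp (-(π * I * q)) * (Complex.exp (-(((π * (μ - q) / 2 : ℝ) : ℂ) * I)) *
        Complex.exp (2 * π * I * q * x)) = E₂ * Complex.exp (2 * π * I * q * ((x - 1 / 4 : ℝ) : ℂ)) := by
      rw [hE₂, ← Complex.exp_add, ← Complex.exp_add, ← Complex.exp_add]; congr 1; push_cast; ring
    have hau : (a q : ℂ) = (t q : ℂ) / ((π * (μ + q) : ℝ) : ℂ) := by rw [ha]; push_cast; ring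
    have hav : (a' q : ℂ) = (t q : ℂ) / ((π * (μ - q) : ℝ) : ℂ) := by rw [ha']; push_cast; ring
    have hne1 : ((π * (μ + q) : ℝ) : ℂ) ≠ 0 := Complex.ofReal_ne_zero.2 (by positivity)
    have hne2 : ((π * (μ - q) : ℝ) : ℂ) ≠ 0 := Complex.ofReal_ne_zero.2 (by positivity)
    have hI2 : (2 * I : ℂ) ≠ 0 := by simp [Complex.I_ne_zero]
    rw [Complex.ofReal_div, Complex.ofReal_div, ofReal_sin_eq_exp_sub, ofReal_sin_eq_exp_sub, hau, hav]
    field_simp at i1 i2 i3 i4 ⊢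
    linear_combination ((t q : ℂ) * ((π * (μ - q) : ℝ) : ℂ)) * i1 - ((t q : ℂ) * ((π * (μ - q) : ℝ) : ℂ)) * i2 +
      ((t q : ℂ) * ((π * (μ + q) : ℝ) : ℂ)) * i3 - ((t q : ℂ) * ((π * (μ + q) : ℝ) : ℂ)) * i4
  rw [Finset.sum_congr rfl hterm, ← Finset.mul_sum]
  -- the four Abel sums
  set F : ℝ → ℂ := fun y => ∑ q ∈ Finset.Icc (-(Q : ℤ)) Q, (a q : ℂ) * Complex.exp (2 * π * I * q * y) with hF
  set F' : ℝ → ℂ := fun y => ∑ q ∈ Finset.Icc (-(Q : ℤ)) Q, (a' q : ℂ) * Complex.exp (2 * π * I * q * y) with hF'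
  have hsum : ∑ q ∈ Finset.Icc (-(Q : ℤ)) Q,
      (E₁ * ((a q : ℂ) * Complex.exp (2 * π * I * q * ((x + 1 / 4 : ℝ) : ℂ))) -
        E₂ * ((a q : ℂ) * Complex.exp (2 * π * I * q * ((x - 1 / 4 : ℝ) : ℂ))) +
        E₁ * ((a' q : ℂ) * Complex.exp (2 * π * I * q * ((x - 3 / 4 : ℝ) : ℂ))) -
        E₂ * ((a' q : ℂ) * Complex.exp (2 * π * I * q * ((x - 1 / 4 : ℝ) : ℂ)))) =
      E₁ * F (x + 1 / 4) - E₂ * F (x - 1 / 4) + E₁ * F' (x - 3 / 4) - E₂ * F' (x - 1 / 4) := by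
    simp only [hF, hF', Finset.mul_sum, ← Finset.sum_sub_distrib, ← Finset.sum_add_distrib]
  rw [hsum]
  -- Abel bounds
  have hQQ : (-(Q : ℤ)) ≤ Q := by omega
  have haA : ∀ q, -(Q : ℤ) ≤ q → q < Q → a (q + 1) ≤ a q := by
    intro q h1 h2
    simp only [ha]
    have hμ1 : 0 < μ + q := (hμq q (Finset.mem_Icc.mpr ⟨h1, h2.le⟩)).1
    have hμ2 : 0 < μ + ((q + 1 : ℤ) : ℝ) := (hμq (q + 1) (Finset.mem_Icc.mpr ⟨by omega, by omega⟩)).1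
    have h := hanti q h1 h2
    rw [mul_comm π, mul_comm π, ← div_div, ← div_div]
    exact div_le_div_of_nonneg_right h hπ.le
  have haB : 0 ≤ a Q := by
    simp only [ha]
    exact div_nonneg (ht0 _) (mul_pos hπ (hμq Q (Finset.mem_Icc.mpr ⟨hQQ, le_rfl⟩)).1).le
  have hFb : ∀ y : ℝ, Real.sin (π * y) ≠ 0 → ‖F y‖ ≤ a (-(Q : ℤ)) / |Real.sin (π * y)| := fun y hy =>
    norm_sum_Icc_antitone_mul_exp_le hQQ haA haB hy
  -- `F'` is `F` reflected (evenness of `t`)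
  have hF'F : ∀ y : ℝ, F' y = F (-y) := by
    intro y
    simp only [hF, hF']
    refine Finset.sum_nbij' (fun q => -q) (fun q => -q) (fun q hq => ?_) (fun q hq => ?_) (fun q _ => by simp)
      (fun q _ => by simp) (fun q hq => ?_)
    · rw [Finset.mem_Icc] at hq ⊢; omega
    · rw [Finset.mem_Icc] at hq ⊢; omega
    · simp only [ha, ha', hte]
      push_cast
      ring_nf
  have hF'b : ∀ y : ℝ, Real.sin (π * y) ≠ 0 → ‖F' y‖ ≤ a (-(Q : ℤ)) / |Real.sin (π * y)| := by
    intro y hy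
    rw [hF'F]
    have hy' : Real.sin (π * (-y)) ≠ 0 := by rwa [mul_neg, Real.sin_neg, neg_ne_zero]
    have h := hFb (-y) hy'
    rwa [mul_neg, Real.sin_neg, abs_neg] at h
  -- assemble
  have hx₃ : Real.sin (π * (x - 3 / 4)) ≠ 0 := by
    intro h; apply hx₁; rw [← abs_eq_zero, ← abs_sin_pi_mul_sub_three_quarters, h, abs_zero]
  have hb1 := hFb (x + 1 / 4) hx₁
  have hb2 := hFb (x - 1 / 4) hx₂
  have hb3 := hF'b (x - 3 / 4) hx₃
  have hb4 := hF'b (x - 1 / 4) hx₂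
  rw [abs_sin_pi_mul_sub_three_quarters] at hb3
  have hI : ‖(1 / (2 * I) : ℂ)‖ = 1 / 2 := by simp
  have haQ : a (-(Q : ℤ)) = t (-(Q : ℤ)) / (μ - Q) / π := by
    simp only [ha]; push_cast; rw [mul_comm π, ← div_div]; ring_nf
  have hs₁ : 0 < |Real.sin (π * (x + 1 / 4))| := abs_pos.mpr hx₁
  have hs₂ : 0 < |Real.sin (π * (x - 1 / 4))| := abs_pos.mpr hx₂
  calc ‖1 / (2 * I) * (E₁ * F (x + 1 / 4) - E₂ * F (x - 1 / 4) + E₁ * F' (x - 3 / 4) - E₂ * F' (x - 1 / 4))‖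
      ≤ 1 / 2 * (‖E₁ * F (x + 1 / 4)‖ + ‖E₂ * F (x - 1 / 4)‖ + ‖E₁ * F' (x - 3 / 4)‖ + ‖E₂ * F' (x - 1 / 4)‖) := by
        rw [norm_mul, hI]
        refine mul_le_mul_of_nonneg_left ?_ (by norm_num)
        refine (norm_sub_le _ _).trans (add_le_add ((norm_add_le _ _).trans (add_le_add (norm_sub_le _ _) le_rfl)) le_rfl)
    _ ≤ 1 / 2 * (a (-(Q : ℤ)) / |Real.sin (π * (x + 1 / 4))| + a (-(Q : ℤ)) / |Real.sin (π * (x - 1 / 4))| +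
          a (-(Q : ℤ)) / |Real.sin (π * (x + 1 / 4))| + a (-(Q : ℤ)) / |Real.sin (π * (x - 1 / 4))|) := by
        rw [norm_mul, norm_mul, norm_mul, norm_mul, hE₁n, hE₂n, one_mul, one_mul, one_mul, one_mul]
        gcongr
    _ = t (-(Q : ℤ)) / (μ - Q) / π * (1 / |Real.sin (π * (x + 1 / 4))| + 1 / |Real.sin (π * (x - 1 / 4))|) := by
        rw [haQ]; field_simp; ring


/-! ## §4 The maximal-ramp trapezoid sampled on the multiples of `N` -/

/-- **The trapezoid ratio on the negative side**: for the trapezoid `(L₁, L₂)` sampled at `Nq`, `μ = L₂/N`, and `−Q ≤ q ≤ 0`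
with `NQ < L₂`: `t(q)/(μ+q) = min(1/(μ+q), N/D)` (`D = L₂ − L₁`; on this side `L₂ − N|q| = N(μ+q)`). [folklore] -/
theorem trapezoid_ratio_of_nonpos {N L₁ L₂ Q : ℕ} (hN : 0 < N) (hL : L₁ < L₂) (hQ : N * Q < L₂) {tt : ℤ → ℝ}
    (htt : ∀ q : ℤ, tt q = min 1 (max 0 (((L₂ : ℝ) - |(N : ℝ) * q|) / ((L₂ : ℝ) - L₁))))
    {q : ℤ} (hq₁ : -(Q : ℤ) ≤ q) (hq₂ : q ≤ 0) :
    tt q / ((L₂ : ℝ) / N + q) = min (1 / ((L₂ : ℝ) / N + q)) ((N : ℝ) / ((L₂ : ℝ) - L₁)) := by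
  have hNr : (0 : ℝ) < N := by exact_mod_cast hN
  have hL' : (L₁ : ℝ) < L₂ := by exact_mod_cast hL
  have hD : (0 : ℝ) < (L₂ : ℝ) - L₁ := by linarith
  have hq₁' : (-(Q : ℤ) : ℝ) ≤ q := by exact_mod_cast hq₁
  have hq₂' : (q : ℝ) ≤ 0 := by exact_mod_cast hq₂
  have hQ' : (N : ℝ) * Q < L₂ := by exact_mod_cast hQ
  push_cast at hq₁'
  have hu : 0 < (L₂ : ℝ) / N + q := by
    rw [div_add' _ _ _ hNr.ne', lt_div_iff₀ hNr]; nlinarith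
  have habs : |(N : ℝ) * q| = -((N : ℝ) * q) := abs_of_nonpos (by nlinarith)
  have hnum : (L₂ : ℝ) - |(N : ℝ) * q| = N * ((L₂ : ℝ) / N + q) := by rw [habs]; field_simp; ring
  rw [htt, hnum, max_eq_right (by positivity), ← min_div_div_right hu.le]
  have hne2 : (L₂ : ℝ) + N * q ≠ 0 := by
    have e : (L₂ : ℝ) + N * q = N * ((L₂ : ℝ) / N + q) := by field_simp
    rw [e]; positivity
  congr 1
  field_simp

/-- **Facts about the sampled trapezoid** used by the Abel bound: with `μ = L₂/N`, `Q = ⌊(L₂−1)/N⌋` (so `NQ < L₂`), the symbol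
`t(q) = min(1, max(0, (L₂ − N|q|)/D))` is non-negative and even, `Q < μ`, the ratio `t(q)/(μ+q)` is non-increasing on `[−Q, Q]`,
and `t(−Q)/(μ−Q) ≤ N/D`. [folklore] -/
theorem trapezoid_sample_facts {N L₁ L₂ : ℕ} (hN : 0 < N) (hL : L₁ < L₂) {tt : ℤ → ℝ}
    (htt : ∀ q : ℤ, tt q = min 1 (max 0 (((L₂ : ℝ) - |(N : ℝ) * q|) / ((L₂ : ℝ) - L₁)))) :
    (∀ q, 0 ≤ tt q) ∧ (∀ q, tt (-q) = tt q) ∧ ((((L₂ - 1) / N : ℕ) : ℝ) < (L₂ : ℝ) / N) ∧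
      (∀ q : ℤ, -(((L₂ - 1) / N : ℕ) : ℤ) ≤ q → q < ((L₂ - 1) / N : ℕ) →
        tt (q + 1) / ((L₂ : ℝ) / N + ((q + 1 : ℤ) : ℝ)) ≤ tt q / ((L₂ : ℝ) / N + q)) ∧
      tt (-(((L₂ - 1) / N : ℕ) : ℤ)) / ((L₂ : ℝ) / N - ((L₂ - 1) / N : ℕ)) ≤ (N : ℝ) / ((L₂ : ℝ) - L₁) := by
  set Q : ℕ := (L₂ - 1) / N with hQdef
  have hNr : (0 : ℝ) < N := by exact_mod_cast hN
  have hL' : (L₁ : ℝ) < L₂ := by exact_mod_cast hL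
  have hD : (0 : ℝ) < (L₂ : ℝ) - L₁ := by linarith
  have hL2r : (0 : ℝ) < L₂ := by have : (0 : ℝ) ≤ L₁ := Nat.cast_nonneg _; linarith
  have hQ : N * Q < L₂ := by
    have h1 : N * Q ≤ L₂ - 1 := by rw [mul_comm]; exact Nat.div_mul_le_self (L₂ - 1) N
    omega
  have hQr : (N : ℝ) * Q < L₂ := by exact_mod_cast hQ
  have hQμ : (Q : ℝ) < (L₂ : ℝ) / N := by rw [lt_div_iff₀ hNr]; linarith
  have ht0 : ∀ q, 0 ≤ tt q := fun q => by rw [htt]; exact le_min zero_le_one (le_max_left _ _)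
  have hte : ∀ q, tt (-q) = tt q := fun q => by rw [htt, htt]; push_cast; rw [mul_neg, abs_neg]
  refine ⟨ht0, hte, hQμ, ?_, ?_⟩
  · intro q hq₁ hq₂
    rcases le_or_gt 0 q with hq0 | hq0
    · -- `q ≥ 0`: `tt` is non-increasing and the denominators increase
      have hqr : (0 : ℝ) ≤ q := by exact_mod_cast hq0
      have hu : 0 < (L₂ : ℝ) / N + q := by positivity
      have hu' : (L₂ : ℝ) / N + q ≤ (L₂ : ℝ) / N + ((q + 1 : ℤ) : ℝ) := by push_cast; linarith
      have hmono : tt (q + 1) ≤ tt q := by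
        rw [htt, htt]
        refine min_le_min le_rfl (max_le_max le_rfl (div_le_div_of_nonneg_right ?_ hD.le))
        have e1 : |(N : ℝ) * ((q + 1 : ℤ) : ℝ)| = N * (q + 1) := by push_cast; exact abs_of_nonneg (by positivity)
        have e2 : |(N : ℝ) * q| = N * q := abs_of_nonneg (by positivity)
        rw [e1, e2]; nlinarith
      calc tt (q + 1) / ((L₂ : ℝ) / N + ((q + 1 : ℤ) : ℝ)) ≤ tt q / ((L₂ : ℝ) / N + ((q + 1 : ℤ) : ℝ)) :=
            div_le_div_of_nonneg_right hmono (by linarith)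
        _ ≤ tt q / ((L₂ : ℝ) / N + q) := div_le_div_of_nonneg_left (ht0 q) hu hu'
    · -- `q ≤ −1`: both ratios are `min(1/(μ+·), N/D)`
      have h1 := trapezoid_ratio_of_nonpos hN hL hQ htt hq₁ hq0.le
      have h2 := trapezoid_ratio_of_nonpos hN hL hQ htt (q := q + 1) (by omega) (by omega)
      rw [h2, h1]
      refine min_le_min ?_ le_rfl
      have hq₁' : (-(Q : ℤ) : ℝ) ≤ q := by exact_mod_cast hq₁
      push_cast at hq₁' ⊢
      have hu : 0 < (L₂ : ℝ) / N + q := by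
        rw [div_add' _ _ _ hNr.ne', lt_div_iff₀ hNr]; nlinarith
      exact one_div_le_one_div_of_le hu (by linarith)
  · have h := trapezoid_ratio_of_nonpos hN hL hQ htt (q := -(Q : ℤ)) le_rfl (neg_nonpos.mpr (Int.natCast_nonneg _))
    push_cast at h ⊢
    rw [← sub_eq_add_neg] at h
    rw [h]
    exact min_le_right _ _


end Summit.AnomalousDissipation.AnomalousDissipation.Theorems.SawtoothPulseCascade.K1Window
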